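import Summits.CriticalPhenomena.PercolationContinuityZ3.Theses.PercLevyKhintchine
import Summits.CriticalPhenomena.PercolationContinuityZ3.Theorems.PercLowPointHalfSpaceHalfSpaceAxisDecay
import Literature.Probability.Percolation.CriticalContinuityProofs

/-!
# Birth skeleton (BC3) for the crux `CritAffineEnergyUnbounded` (stmt-CriticalPhenomena-2167)

Route `route-CriticalPhenomena-PercLevyKhintchine` (sub-problem `PercolationContinuityZ3`), crux decl
`Summit.CriticalPhenomena.PercolationContinuityZ3.Theses.PercLevyKhintchine.CritAffineEnergyUnbounded`
(rank 3, "(IA)"): at `p = p_c(ℤ³)` the affine energies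
`E(x,c) = Σ_{ij} c_i c_j ψ(x_i,x_j)`, `ψ = -log τ_{p_c}`, `Σ_i c_i = 1`, are unbounded above.

STATUS OF THE CRUX (route header HONEST LABEL; refuter 3bae3c4d, `R3Evidence.lean`): (IA) has no
content independent of the conjunct — `(IA) ⟺ ¬(ID)(p_c) ∨ [unbounded circumradii of the
Schoenberg-embedded critical orbit]`, and every conjunct-level input must be a nearest-neighbour-`ℤ³`
fact (barrier `LongRangeDiscontinuity`: (ID), `τ ≥ θ²` and BCR 4.3.15 hold verbatim for the
Aizenman–Newman `1/r²` chain, where `θ(p_c) > 0`). The route header names the candidate input: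
Barsky–Grimmett–Newman, no half-space percolation at `p_c(ℤ³)` — PROVED in the tree
(`BarskyGrimmettNewman1991_Z3_holds`; normal-axis corollary `halfSpaceAxisDecay_proof`).

THE LINE ("boundary-to-bulk transfer of the critical Lévy mass"). Write `ℍ = {z | 0 ≤ z₀}`,
`τ^ℍ(x,y) = P_{p_c}(x ↔ y inside ℍ)` (`openConnIn {x | 0 ≤ x 0}`, the vocabulary of route
PercLowPointHalfSpace), `ψ^ℍ = -log τ^ℍ`, `e₁ = Pi.single 1 1` (a TANGENTIAL direction: `0` and
`n e₁` both lie in the boundary plane `{z₀ = 0}`, on which both `ψ(0, ·)` and `ψ^ℍ(0, ·)` are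
restrictions of `ℤ²`-stationary kernels). The composition is the DICHOTOMY on (ID) at `p_c`:

* `¬ NegTypeAtPc` (some sum-zero `c` has `Σ c_i c_j ψ(x_i,x_j) > 0`): the energies along the two
  rays `δ_{i₀} ± t·c` (affine weights) add up to `2 t² · Σ c_i c_j ψ_{ij} → ∞`, so one of them is
  unbounded — the crux holds OUTRIGHT (`critAffine_of_not_negTypeAtPc`, PROVED here; = theorem (a)
  of `R3Evidence.lean`).
* `NegTypeAtPc`: STUB 2 (fed by STUB 1) bounds the bulk connectivity along the tangential axis by a
  power of the half-space connectivity, `τ_{p_c}(0, n e₁) ≤ K · τ^ℍ_{p_c}(0, n e₁)^α`; BGN along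
  that axis (`halfSpacePlaneAxisDecay`, PROVED here from
  `Theorems.ae_finite_openClusterIn_halfSpace_criticalProbI`) gives `τ^ℍ_{p_c}(0, n e₁) → 0`, hence
  `τ_{p_c}(0, n e₁) → 0`, `ψ(0, n e₁) → ∞` (`τ_{p_c} > 0`: `tau_pos`, `criticalProb_zd_pos`), and
  PAIRS SUFFICE: the energy of `{0, y}` with weights `(1/2, 1/2)` is `ψ(0,y)/2`
  (`critAffine_of_psi_unbounded`, PROVED; = theorem (b) of `R3Evidence.lean`).

Registered stubs (the ONLY `sorry`s):

* STUB 1 `stub_halfSpaceNegType` (L, OPEN — the (ID)-family on the half-space): the half-space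
  kernel `ψ^ℍ_{p_c}` is conditionally negative definite on `ℍ`
  (`Σ c_i c_j log τ^ℍ(x_i,x_j) ≥ 0` for `Σ c = 0`, points in `ℍ`). Expected to follow from the
  route's support item `CuboidLogConnNegType` (stmt-2170: all cuboids, all `p`) by exhausting `ℍ`
  with face-anchored cuboids (continuity from below; the CND cone is closed under pointwise limits);
  refutable by the same exact enumeration on a cuboid with ONE free face playing the boundary.
  Role: gives the half-space Schoenberg embedding `b^ℍ : ℍ → H'`, `‖b^ℍ x − b^ℍ y‖² = ψ^ℍ(x,y)`,
  `ℤ²`-equivariant under plane translations — the second of the two embeddings STUB 2 compares.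
* STUB 2 `stub_bulkDominatesBoundary` (XL, OPEN — LOAD-BEARING): `NegTypeAtPc → HalfSpaceNegTypeAtPc →
  ∃ K α, 0 < α ∧ ∀ n, τ_{p_c}(0, n e₁) ≤ K · τ^ℍ_{p_c}(0, n e₁)^α` — in embedding language
  `‖b(n e₁) − b(0)‖² ≥ α ‖b^ℍ(n e₁) − b^ℍ(0)‖² − log K`: the bulk orbit does not collapse relative to
  the boundary orbit along the plane; in Lévy–Khintchine language (both sides are `ℤ²`-stationary
  negative definite functions on the boundary plane, Lévy measures `ν_∥`, `ν^ℍ_∥` on `𝕋²`):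
  `ν_∥ − α ν^ℍ_∥ ≥ −(finite measure)`. Real-world forecast: TRUE with any
  `α < (d−2+η)/(d−2+η_∥) ≈ 0.95/2.2` (bulk vs ordinary-surface two-point exponents of 3D percolation);
  in a `θ(p_c) > 0` world FALSE (bulk `ψ` bounded by `−2 log θ(p_c)`, `ψ^ℍ → ∞` by BGN) — so, given
  BGN, STUB 2 is conjunct-strength (honest; the crux itself is conjunct-equivalent given (ID)). What
  it exposes that the crux does not: a comparison of TWO connectivities of the same model at the
  same scale (no rate in `n` is asked), attackable by the excursion decomposition of a bulk
  plane-to-plane connection into half-space excursions on either side of the plane (reflection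
  symmetry + BK: `τ|_plane ≤ Σ_m (τ^ℍ|_plane)^{*m}`, the one structural bulk/boundary relation in
  print) and by the negative-type calculus of the two embeddings (5-point / pentagonal inequalities
  of (ID) bound products of bulk connectivities by hub connectivities).

`CritAffineEnergyUnbounded_of : __Registered.stub_halfSpaceNegType → __Registered.stub_bulkDominatesBoundary →
CritAffineEnergyUnbounded` is the only declaration concluding the crux decl (kernel-checked, no
`sorry` outside the two stubs; the helpers conclude the local unfolded form `AffineUnbounded`,
`affineUnbounded_iff := Iff.rfl`).

DISPROOF USED: none exists for this crux (`ledger crux ls stmt-CriticalPhenomena-2167`: no workfiles,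
no `Disproof.lean`, no landed `Negative/` lemma, 2026-08-17). The refuter's structural theorems (a),
(b) of `R3Evidence.lean` are honoured by construction: (a) IS the negative branch of the dichotomy and
(b) IS the last step of the positive branch, so the stubs carry exactly the "nearest-neighbour `ℤ³`
input at `p_c`" the review asked for (BGN, here in proved form) plus the transfer statement.
Negatives index of the summit (11 refuted statements, 2026-08-17): no half-space / negative-type
statement among them; STUB 1 is not an instance of stmt-8261 (SAW edge kernel, hexagonal lattice).
-/

noncomputable section

namespace Summit.CriticalPhenomena.PercolationContinuityZ3.Cruxes.CritAffineEnergyUnbounded.Birth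

open MeasureTheory Filter Topology
open Literature.Probability.Percolation Literature.Probability.LatticeModels
open Summit.CriticalPhenomena.PercolationContinuityZ3.Theses.PercLevyKhintchine (CritAffineEnergyUnbounded)

/-! ## Objects of the line -/

/-- The critical bond percolation measure on `ℤ³`. -/
abbrev μc : Measure (BondConfig (Site 3)) := bondPercolation (zdGraph 3) (criticalProbI 3)

/-- The critical connectivity logarithm `ψ(x,y) = -log τ_{p_c}(x,y)` (bulk, `ℤ³`). -/
def ψ (x y : Site 3) : ℝ := -Real.log (tau 3 (criticalProbI 3) x y)

/-- The half-space-restricted critical connectivity `τ^ℍ(x,y) = P_{p_c}(x ↔ y inside ℍ)`,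
`ℍ = {z | 0 ≤ z₀}` (the `openConnIn {x | 0 ≤ x 0}` vocabulary of route PercLowPointHalfSpace). -/
def tauH (x y : Site 3) : ℝ := μc.real (openConnIn {z : Site 3 | 0 ≤ z 0} x y)

/-- The point `n·e₁` of the tangential axis (inside the boundary plane `{z₀ = 0}` of `ℍ`). -/
def planePt (n : ℕ) : Site 3 := Pi.single 1 (n : ℤ)

/-- The unfolded form of the crux in the line's notation: affine energies of `ψ` are unbounded. -/
def AffineUnbounded : Prop :=
  ∀ C : ℝ, ∃ (n : ℕ) (x : Fin n → Site 3) (c : Fin n → ℝ),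
    ∑ i, c i = 1 ∧ C < ∑ i, ∑ j, c i * c j * ψ (x i) (x j)

/-- The crux is literally `AffineUnbounded`. -/
theorem affineUnbounded_iff : CritAffineEnergyUnbounded ↔ AffineUnbounded := Iff.rfl

/-! ## Statements -/

/-- (ID) at `p = p_c(ℤ³)`: the bulk critical connectivity logarithm is conditionally negative
definite — the instance `p = criticalProbI 3` of the route's crux r2 `LogConnNegType`. Used only as
the ANTECEDENT of STUB 2 (the dichotomy of the composition: if it fails, the crux holds outright,
`critAffine_of_not_negTypeAtPc`). -/
def NegTypeAtPc : Prop :=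
  ∀ (n : ℕ) (x : Fin n → Site 3) (c : Fin n → ℝ), ∑ i, c i = 0 →
    0 ≤ ∑ i, ∑ j, c i * c j * Real.log (tau 3 (criticalProbI 3) (x i) (x j))

/-- STUB 1 statement: the HALF-SPACE critical connectivity logarithm
`ψ^ℍ(x,y) = -log P_{p_c}(x ↔ y inside ℍ)` is conditionally negative definite on `ℍ = {z | 0 ≤ z₀}`. -/
def HalfSpaceNegTypeAtPc : Prop :=
  ∀ (n : ℕ) (x : Fin n → Site 3) (c : Fin n → ℝ), (∀ i, 0 ≤ x i 0) → ∑ i, c i = 0 →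
    0 ≤ ∑ i, ∑ j, c i * c j *
      Real.log ((bondPercolation (zdGraph 3) (criticalProbI 3)).real
        (openConnIn {z : Site 3 | 0 ≤ z 0} (x i) (x j)))

/-- STUB 2 statement: BULK DOMINATES BOUNDARY along the tangential axis — given negative type of
both kernels, the bulk connectivity from `0` to `n e₁` is at most a constant times a positive power
of the half-space connectivity: `τ_{p_c}(0, n e₁) ≤ K · τ^ℍ_{p_c}(0, n e₁)^α`, `α > 0`. -/
def BulkDominatesBoundary : Prop :=
  NegTypeAtPc → HalfSpaceNegTypeAtPc →
    ∃ K α : ℝ, 0 < α ∧ ∀ n : ℕ,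
      tau 3 (criticalProbI 3) 0 (Pi.single 1 (n : ℤ)) ≤
        K * ((bondPercolation (zdGraph 3) (criticalProbI 3)).real
              (openConnIn {z : Site 3 | 0 ≤ z 0} 0 (Pi.single 1 (n : ℤ)))) ^ α

/-! ## Registered stubs (the ONLY `sorry`s of this file) -/

/-- **STUB 1 `halfSpaceNegType`** (L, OPEN — the (ID)-family on `ℍ`): for points `x_1 … x_n ∈ ℍ`
and real weights with `Σ c = 0`, `Σ_{ij} c_i c_j log P_{p_c}(x_i ↔ x_j inside ℍ) ≥ 0`. Why it might
fail: boundary entropy pockets (the (ID)-test fails off-lattice on `K_{2,5}`; thin free-boundary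
slabs passed with margins 0.04–0.44 in the card's enumeration); a proof must use the product
structure of `ℤ³` exactly as for r2. Sources: route items stmt-2166 (r2), stmt-2170
(`CuboidLogConnNegType`, which implies it by exhaustion), card levy-khintchine-connectivity. -/
theorem stub_halfSpaceNegType : HalfSpaceNegTypeAtPc := by
  sorry

/-- **STUB 2 `bulkDominatesBoundary`** (XL, OPEN — LOAD-BEARING): under negative type of the bulk
and of the half-space kernel at `p_c`, `∃ K α, 0 < α ∧ ∀ n, τ_{p_c}(0, n e₁) ≤ K τ^ℍ_{p_c}(0, n e₁)^α`.
Why it might fail: given BGN it is conjunct-strength (false iff `θ(p_c(ℤ³)) > 0`); unconditionally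
no bulk ≤ f(boundary) comparison of critical connectivities is in print in any `d` (the excursion /
renewal bound needs the plane-sum of long half-space excursions to be small against the slab mass,
i.e. a quantitative BGN, cf. `PercLowPointHalfSpace.QuantitativeBGN`). Sources: BarskyGrimmettNewman1991
(Grimmett1999 Thm (7.35)); book:berg1984-harmonic-analysis-semigroups Prop 4.3.15 (Lévy–Khintchine on
`ℤ²` for both plane kernels); CampaninoIoffeVelenik2008 (renewal structure of connectivities);
DengBlote2005 doi:10.1103/PhysRevE.71.016117 (surface exponents of 3D percolation, the forecast for α). -/
theorem stub_bulkDominatesBoundary : BulkDominatesBoundary := by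
  sorry

/-! ### Name-keyed aliases of the stub statements (hypotheses of the composition) -/
namespace __Registered

/-- Alias of `HalfSpaceNegTypeAtPc` keyed by the registered stub name. -/
abbrev stub_halfSpaceNegType : Prop := HalfSpaceNegTypeAtPc
/-- Alias of `BulkDominatesBoundary` keyed by the registered stub name. -/
abbrev stub_bulkDominatesBoundary : Prop := BulkDominatesBoundary

end __Registered

/-! ## Proved plumbing -/

/-! ### (a) The quadratic-form algebra of affine energies -/

/-- The bilinear form of a kernel `k` on `Fin n`. -/
def Q {n : ℕ} (k : Fin n → Fin n → ℝ) (u v : Fin n → ℝ) : ℝ := ∑ i, ∑ j, u i * v j * k i j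

theorem Q_expand {n : ℕ} (k : Fin n → Fin n → ℝ) (u v : Fin n → ℝ) (s : ℝ) :
    Q k (fun i => u i + s * v i) (fun i => u i + s * v i) =
      Q k u u + s * (Q k u v + Q k v u) + s ^ 2 * Q k v v := by
  have h : ∀ i j, (u i + s * v i) * (u j + s * v j) * k i j =
      u i * u j * k i j + (s * (u i * v j * k i j) + s * (v i * u j * k i j)) +
        s ^ 2 * (v i * v j * k i j) := by
    intro i j; ring
  simp only [Q, h, Finset.sum_add_distrib, ← Finset.mul_sum]
  ring

theorem Q_delta_left {n : ℕ} (k : Fin n → Fin n → ℝ) (i₀ : Fin n) (v : Fin n → ℝ) :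
    Q k (fun i => if i = i₀ then 1 else 0) v = ∑ j, v j * k i₀ j := by
  unfold Q
  rw [Finset.sum_eq_single i₀]
  · simp
  · intro i _ hi
    simp [hi]
  · intro h
    exact absurd (Finset.mem_univ i₀) h

theorem sum_delta_add_smul {n : ℕ} (i₀ : Fin n) (c : Fin n → ℝ) (hc : ∑ i, c i = 0) (s : ℝ) :
    ∑ i, ((if i = i₀ then (1 : ℝ) else 0) + s * c i) = 1 := by
  rw [Finset.sum_add_distrib, ← Finset.mul_sum, hc, mul_zero, add_zero]
  simp

/-- **Dichotomy, negative branch** (refuter 3bae3c4d's theorem (a), re-proved): if (ID) FAILS at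
`p_c` on some configuration — a sum-zero `c` with `Σ c_i c_j ψ(x_i,x_j) > 0` — then the affine
energies along the rays `δ_{i₀} ± t c` are unbounded, so the crux holds outright. -/
theorem critAffine_of_not_negTypeAtPc (h : ¬ NegTypeAtPc) : AffineUnbounded := by
  classical
  unfold NegTypeAtPc at h
  push Not at h
  obtain ⟨n, x, c, hc0, hneg⟩ := h
  -- the kernel and the positive direction
  set k : Fin n → Fin n → ℝ := fun i j => ψ (x i) (x j) with hk
  have hQ : Q k c c = -∑ i, ∑ j, c i * c j * Real.log (tau 3 (criticalProbI 3) (x i) (x j)) := by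
    simp only [Q, hk, ψ, ← Finset.sum_neg_distrib]
    refine Finset.sum_congr rfl fun i _ => Finset.sum_congr rfl fun j _ => ?_
    ring
  have hP : 0 < Q k c c := by rw [hQ]; linarith
  have hn : 0 < n := by
    rcases Nat.eq_zero_or_pos n with rfl | hn
    · simp at hneg
    · exact hn
  set i₀ : Fin n := ⟨0, hn⟩ with hi₀
  set δ : Fin n → ℝ := fun i => if i = i₀ then 1 else 0 with hδ
  have hδδ : Q k δ δ = 0 := by
    rw [hδ, Q_delta_left]
    simp [hk, ψ]
  intro C
  -- the parameter `t` with `t² · Q(c,c) > C`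
  set t : ℝ := |C| / Q k c c + 1 with ht
  have ht1 : 1 ≤ t := by
    have := div_nonneg (abs_nonneg C) hP.le
    linarith
  have htP : C < t ^ 2 * Q k c c := by
    have h1 : t * Q k c c = |C| + Q k c c := by
      rw [ht]; field_simp
    have h2 : t * Q k c c ≤ t ^ 2 * Q k c c := by
      have h0 : 0 ≤ t * Q k c c := by rw [h1]; positivity
      nlinarith
    calc C ≤ |C| := le_abs_self C
      _ < |C| + Q k c c := by linarith
      _ = t * Q k c c := h1.symm
      _ ≤ t ^ 2 * Q k c c := h2
  -- energies along `δ + t c` and `δ - t c`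
  have hplus := Q_expand k δ c t
  have hminus := Q_expand k δ c (-t)
  rw [hδδ] at hplus hminus
  have hE : ∀ s : ℝ, (∑ i, ∑ j, (δ i + s * c i) * (δ j + s * c j) * ψ (x i) (x j)) =
        Q k (fun i => δ i + s * c i) (fun i => δ i + s * c i) := by
    intro s; rfl
  by_cases hcase : C < Q k (fun i => δ i + t * c i) (fun i => δ i + t * c i)
  · refine ⟨n, x, fun i => δ i + t * c i, sum_delta_add_smul i₀ c hc0 t, ?_⟩
    rw [hE]; exact hcase
  · refine ⟨n, x, fun i => δ i + (-t) * c i, sum_delta_add_smul i₀ c hc0 (-t), ?_⟩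
    rw [hE, hminus]
    push Not at hcase
    rw [hplus] at hcase
    have e1 : (-t) * (Q k δ c + Q k c δ) = -(t * (Q k δ c + Q k c δ)) := by ring
    have e2 : (-t) ^ 2 * Q k c c = t ^ 2 * Q k c c := by ring
    rw [e1, e2]
    linarith

/-! ### (b) Pairs: the energy of the pair `{0, y}` with weights `(1/2, 1/2)` is `ψ(0,y)/2` -/

theorem energy_pair (y : Site 3) :
    (∑ i : Fin 2, ∑ j : Fin 2, (![1 / 2, 1 / 2] : Fin 2 → ℝ) i * (![1 / 2, 1 / 2] : Fin 2 → ℝ) j *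
        ψ ((![0, y] : Fin 2 → Site 3) i) ((![0, y] : Fin 2 → Site 3) j)) = ψ 0 y / 2 := by
  simp [Fin.sum_univ_two, tau_comm _ y 0, ψ]
  ring

theorem sum_pair_weights : (∑ i : Fin 2, (![1 / 2, 1 / 2] : Fin 2 → ℝ) i) = 1 := by
  simp [Fin.sum_univ_two]
  norm_num

/-- Pairs suffice (refuter 3bae3c4d's theorem (b), re-proved): unbounded `ψ(0,·)` gives the crux. -/
theorem critAffine_of_psi_unbounded (h : ∀ C : ℝ, ∃ y : Site 3, C < ψ 0 y) :
    AffineUnbounded := by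
  intro C
  obtain ⟨y, hy⟩ := h (2 * C)
  refine ⟨2, ![0, y], ![1 / 2, 1 / 2], sum_pair_weights, ?_⟩
  rw [energy_pair]
  linarith

/-! ### (c) Barsky–Grimmett–Newman along the tangential axis (PROVED input, tree: `θ_ℍ(p_c) = 0`) -/

/-- `P_{p_c}(0 ↔ n e₁ inside ℍ) → 0`: the half-space cluster of the origin is a.s. finite at
`p_c(ℤ³)` (`Theorems.ae_finite_openClusterIn_halfSpace_criticalProbI`, from
`BarskyGrimmettNewman1991_Z3_holds`), so a.e. configuration lies in only finitely many of the
events `{0 ↔ n e₁ in ℍ}` (same argument as `halfSpaceAxisDecay_proof`, tangential instead of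
normal axis). -/
theorem halfSpacePlaneAxisDecay :
    Tendsto (fun n : ℕ => (bondPercolation (zdGraph 3) (criticalProbI 3)).real
      (openConnIn {x : Site 3 | 0 ≤ x 0} 0 (Pi.single 1 (n : ℤ) : Site 3))) atTop (𝓝 0) := by
  have h0 : (0 : Site 3) ∈ {x : Site 3 | 0 ≤ x 0} := Set.mem_setOf.mpr le_rfl
  have hinj : Function.Injective (fun n : ℕ => (Pi.single 1 (n : ℤ) : Site 3)) := by
    intro m n hmn
    have h := congrFun hmn 1
    simp only [Pi.single_eq_same, Nat.cast_inj] at h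
    exact h
  have hmeas : ∀ n : ℕ, MeasurableSet
      (openConnIn {x : Site 3 | 0 ≤ x 0} 0 (Pi.single 1 (n : ℤ) : Site 3) :
        Set (BondConfig (Site 3))) := fun n => by
    rw [openConnIn_eq_openConnVia h0]
    exact measurableSet_openConnVia _ _ _
  have hev : ∀ᵐ ω ∂(bondPercolation (zdGraph 3) (criticalProbI 3)), ∀ᶠ n : ℕ in atTop,
      ω ∉ (openConnIn {x : Site 3 | 0 ≤ x 0} 0 (Pi.single 1 (n : ℤ) : Site 3) :
        Set (BondConfig (Site 3))) := by
    filter_upwards [Summit.CriticalPhenomena.PercolationContinuityZ3.Theorems.ae_finite_openClusterIn_halfSpace_criticalProbI]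
      with ω hω
    have hc : ∀ᶠ y in cofinite, y ∉ openClusterIn (withinGraph ⊤ {x : Site 3 | 0 ≤ x 0}) ω 0 :=
      hω.compl_mem_cofinite
    have hn := hinj.tendsto_cofinite.eventually hc
    rw [Nat.cofinite_eq_atTop] at hn
    filter_upwards [hn] with n hn'
    rw [openConnIn_eq_openConnVia h0]
    exact hn'
  have hT := Literature.Probability.Process.tendsto_measure_of_ae_eventually_notMem hmeas hev
  have hR := (ENNReal.tendsto_toReal ENNReal.zero_ne_top).comp hT
  rw [ENNReal.toReal_zero] at hR
  exact hR

/-! ### (d) Domination transports the half-space decay to the bulk -/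

theorem tau_plane_tendsto_zero {K α : ℝ} (hα : 0 < α)
    (hdom : ∀ n : ℕ, tau 3 (criticalProbI 3) 0 (Pi.single 1 (n : ℤ)) ≤
      K * ((bondPercolation (zdGraph 3) (criticalProbI 3)).real
            (openConnIn {z : Site 3 | 0 ≤ z 0} 0 (Pi.single 1 (n : ℤ)))) ^ α) :
    Tendsto (fun n : ℕ => tau 3 (criticalProbI 3) 0 (Pi.single 1 (n : ℤ))) atTop (𝓝 0) := by
  have h1 : Tendsto (fun n : ℕ => K * ((bondPercolation (zdGraph 3) (criticalProbI 3)).real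
      (openConnIn {z : Site 3 | 0 ≤ z 0} 0 (Pi.single 1 (n : ℤ)))) ^ α) atTop (𝓝 0) := by
    have h := (halfSpacePlaneAxisDecay.rpow_const (Or.inr hα.le)).const_mul K
    simpa [Real.zero_rpow hα.ne'] using h
  exact tendsto_of_tendsto_of_tendsto_of_le_of_le tendsto_const_nhds h1
    (fun n => tau_nonneg _ _ _) hdom

theorem psi_plane_unbounded
    (h0 : Tendsto (fun n : ℕ => tau 3 (criticalProbI 3) 0 (Pi.single 1 (n : ℤ))) atTop (𝓝 0))
    (C : ℝ) : ∃ y : Site 3, C < ψ 0 y := by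
  have hε : (0 : ℝ) < Real.exp (-C) := Real.exp_pos _
  obtain ⟨n, hn⟩ := ((tendsto_order.1 h0).2 _ hε).exists
  refine ⟨Pi.single 1 (n : ℤ), ?_⟩
  have hpc : 0 < ((criticalProbI 3 : unitInterval) : ℝ) := criticalProb_zd_pos 3 (by norm_num)
  have hpos : 0 < tau 3 (criticalProbI 3) 0 (Pi.single 1 (n : ℤ)) :=
    tau_pos zdGraph_preconnected_holds _ hpc _ _
  have hlog : Real.log (tau 3 (criticalProbI 3) 0 (Pi.single 1 (n : ℤ))) < -C := by
    have := Real.log_lt_log hpos hn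
    rwa [Real.log_exp] at this
  unfold ψ
  linarith

/-! ## The composition, by name -/

/-- **`CritAffineEnergyUnbounded_of`**: the two registered stubs imply the crux
`Summit.CriticalPhenomena.PercolationContinuityZ3.Theses.PercLevyKhintchine.CritAffineEnergyUnbounded`
(kernel-checked; no `sorry` outside the stubs). Dichotomy on (ID) at `p_c`: if it fails, the
violating direction is a ray of unbounded energy; if it holds, STUB 2 (fed by STUB 1) and
Barsky–Grimmett–Newman along the tangential axis make `ψ(0, n e₁) → ∞`, and pairs suffice. -/
theorem CritAffineEnergyUnbounded_of (h₁ : __Registered.stub_halfSpaceNegType)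
    (h₂ : __Registered.stub_bulkDominatesBoundary) : CritAffineEnergyUnbounded := by
  rw [affineUnbounded_iff]
  by_cases hID : NegTypeAtPc
  · obtain ⟨K, α, hα, hdom⟩ := h₂ hID h₁
    exact critAffine_of_psi_unbounded (psi_plane_unbounded (tau_plane_tendsto_zero hα hdom))
  · exact critAffine_of_not_negTypeAtPc hID

/-- Wiring check: the registered stubs feed `CritAffineEnergyUnbounded_of` as stated. -/
example : CritAffineEnergyUnbounded :=
  CritAffineEnergyUnbounded_of stub_halfSpaceNegType stub_bulkDominatesBoundary

end Summit.CriticalPhenomena.PercolationContinuityZ3.Cruxes.CritAffineEnergyUnbounded.Birth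

end
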